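import Mathlib.Topology.Algebra.Module.FiniteDimension
import Mathlib.Analysis.Normed.Module.FiniteDimension
import Literature.MathematicalPhysics.QuantumFieldTheory.Dimock2011to13.QED3FermionNorm
import Literature.MathematicalPhysics.QuantumFieldTheory.Dimock2011to13.QED3GaussianIntegralBound
import Literature.MathematicalPhysics.QuantumFieldTheory.Dimock2011to13.QED3SmallFieldFermionRatio
import HarnessLib

/-!
# Dimock, *Quantum electrodynamics on the 3-torus I*, App. B (299) «We define a norm `‖·‖_h` depending on a parameter
# `h > 0`» with LEMMA 19 «`‖FG‖_h ≤ ‖F‖_h‖G‖_h`» (= *Ultraviolet stability for QED in d = 3*, App. B (529)∕(531)), PACKAGED: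
# the finite Grassmann algebra with `‖·‖_h` IS a complete normed algebra with `‖1‖ = 1` (Lean instances on a type
# synonym), so that the Banach-algebra steps of the papers — here D8 LEMMA 26's (511)–(514) — apply to it verbatim

statement-level skeleton of published theorems with citation tags; proofs where landed; nothing here is a claim about the Yang–Mills mass gap

**Citation header (reproduction of PUBLISHED work).** J. Dimock, *Quantum electrodynamics on the 3-torus. I*,
arXiv:math-ph/0210020 [Dimock2002QED3TorusI], App. B (298)–(299) p.62 L1–13 and LEMMA 19 p.62 L14–24 (in the tree as
`QED3FermionNorm`: `hNorm`, `hNorm_mul_le`, `hNorm_one`, `hNorm_smul`, `hNorm_add_le`); J. Dimock, *Ultraviolet stability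
for QED in d = 3*, Ann. Henri Poincaré **23** (2022) 2113–2205 (= arXiv:2009.01156v2) [Dimock2022UVStabilityQED3], App. B
«Norms» (528)–(531) p.73 L25 – p.74 L11 (the same norm, `‖E‖_h = Σ_n hⁿ∕n! ‖E_n‖`) and §4.2.3 LEMMA 26 proof (511)–(514)
p.69 L112 – p.70 L33 with p.61 L57 «`|∫f(Ψ)dμ_I(Ψ)| ≤ ‖f‖₁`» (in the tree, for an ABSTRACT complete normed algebra, as
`QED3SmallFieldFermionRatio`).  Writer seat p11 (literature-prover-lit-balaban-p11-g25-0), YM LIT SWEEP item (c) D8∕D12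
(rows C08∕C12; zero weight for the YM-INPRINT tokens).

**The printed text (verbatim, text layer of D12, p.62 L9–14).** *"We define a norm `‖·‖_h` depending on a parameter
`h > 0` by `‖F‖_h = Σ_r (h^r∕r!)‖f_r‖₁` (299) where `‖f_r‖₁` is the `ℓ¹` norm. Lemma 19 `‖FG‖_h ≤ ‖F‖_h‖G‖_h`."*
D8 p.70 L19–31: *"`sup_{0≤t≤1}‖E**_K(Λ_K)exp(tE**_K(Λ_K))‖₁ ≤ ‖E**_K(Λ_K)‖₁exp(‖E**_K(Λ_K)‖₁)`"* — the papers USE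
`(𝒢, ‖·‖_h)` as a normed algebra (exponentials, `‖e^E‖ ≤ e^{‖E‖}`, products).

**What is formalized (kernel-checked, zero `sorry`, no named facts; definition lane: a type synonym + instances).**
* `HGrassmann 𝕜 ι h` — the tree's Grassmann algebra `QuantumLattice.GrassmannAlgebra 𝕜 ι` (`𝕜 = ℝ` or `ℂ`, finitely many
  linearly ordered generators `ι`) REGARDED AS NORMED BY `‖·‖_h` (`QED3TorusI.hNorm h`), a type synonym carrying the
  same `Ring`∕`Algebra 𝕜` structure (`toGrassmann` ∕ `ofGrassmann` are the identity).
* For `h > 0` (`[Fact (0 < h)]`, the printed «parameter `h > 0`»): `instNormedAddCommGroup` (from the `AddGroupNorm`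
  `hAddGroupNorm`: (299) is a norm — `hNorm_zero`, `hNorm_neg`, `hNorm_add_le`, and definiteness
  `eq_zero_of_hNorm_eq_zero` via the monomial basis), **`instNormedRing`** (LEMMA 19 = `norm_mul_le`), `instNormOneClass`
  (`‖1‖_h = 1`), `instNormedSpace`∕**`instNormedAlgebra`** over `𝕜` (`‖cF‖_h = |c|‖F‖_h`), `instFiniteDimensional`
  (the monomial basis is finite) and **`instCompleteSpace`** — i.e. `(𝒢, ‖·‖_h)` is a complete normed (Banach) algebra
  with `‖1‖ = 1`; `norm_def`, `norm_toGrassmann_one`, `norm_gen`, `norm_grassmannBasis` unfold the norm.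
* `exp_eq_grassmannExp` — on nilpotent elements (`E^k = 0`) Mathlib's `NormedSpace.exp E` (the `e^E` of (511)–(514))
  equals the tree's algebraic `QuantumLattice.grassmannExp E` (finite exponential series): one exponential, two APIs.
* `algebraReal`∕`normedAlgebraReal` — the real scalar structure through `ℝ → 𝕜` as reducible `def`s (NOT instances,
  so no instance diamond is put on the synonym; use `letI`).
* **`norm_functional_exp_sub_one_le_grassmann`** and **`lemma26_closing_grassmann`** — D8 (511)–(514) ON THE GRASSMANN
  ALGEBRA: for any additive functional `μ` with `|μ F| ≤ ‖F‖_h` and `μ 1 = 1` (e.g. a Gaussian Grassmann integral under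
  the tree's `QED3GaussianIntegralBound.norm_gaussExpect_le_hNorm`, D12 LEMMA 21), `|μ(e^E) − 1| ≤ ‖E‖_h e^{‖E‖_h}`
  and, with (513)'s bound and the printed smallness, `|μ(e^E) − 1| ≤ e_K^{1∕4−8ε}` — the abstract theorems of
  `QED3SmallFieldFermionRatio` instantiated (`exp` = Mathlib's `NormedSpace.exp` in the Banach algebra `HGrassmann`);
  **`norm_gaussExpect_exp_sub_one_le`** — the same for the tree's Gaussian Grassmann integral `gaussExpect 𝕜 Γ` under
  D12 LEMMA 21's hypothesis `√‖Γ‖₍₂₎ ≤ h` (`QED3TorusI.norm_gaussExpect_le_hNorm`, `gaussExpect_one`):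
  `|∫e^{E}dμ_Γ − 1| ≤ ‖E‖_h e^{‖E‖_h}`.

**Readings (declared).**  (i) The synonym is a packaging device: all statements are about the tree's `hNorm`.  (ii) `exp_eq_grassmannExp`
needs nilpotency (no constant term); for a general `E = c·1 + N` one has `e^E = e^c·grassmannExp N` (not spelled out).
(iii) Nothing of (504)–(510), (512)–(513) is reproduced.

**Honest scope.**  Instances and two corollaries; no new estimate.  No `d = 4` statement; nothing about Bałaban's
papers.
-/

noncomputable section

namespace Literature.MathematicalPhysics.QuantumFieldTheory.Dimock2011to13

open Literature.MathematicalPhysics.QuantumLattice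
open Literature.MathematicalPhysics.QuantumLattice.GrassmannAlgebra
open QED3TorusI

/-- **The Grassmann algebra normed by `‖·‖_h`**: a type synonym of the tree's `GrassmannAlgebra 𝕜 ι` on which the norm
(299)∕(529) `‖F‖_h = Σ_S h^{#S}|c_S(F)|` (`QED3TorusI.hNorm h`) is registered as THE norm.
[cite: Dimock2002QED3TorusI, App. B (299) p.62 L9–13; Dimock2022UVStabilityQED3, App. B (529) p.73 L25–60] -/
@[nolint unusedArguments]
def HGrassmann (𝕜 : Type*) [RCLike 𝕜] (ι : Type*) [LinearOrder ι] [Fintype ι] (_h : ℝ) : Type _ :=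
  GrassmannAlgebra 𝕜 ι

namespace HGrassmann

variable {𝕜 : Type*} [RCLike 𝕜] {ι : Type*} [LinearOrder ι] [Fintype ι] {h : ℝ}

/-- the same ring as the Grassmann algebra. [cite: Dimock2002QED3TorusI, App. B (298) p.62 L1–8] -/
instance instRing : Ring (HGrassmann 𝕜 ι h) := inferInstanceAs (Ring (GrassmannAlgebra 𝕜 ι))

/-- the same `𝕜`-algebra as the Grassmann algebra. [cite: Dimock2002QED3TorusI, App. B (298) p.62 L1–8] -/
instance instAlgebra : Algebra 𝕜 (HGrassmann 𝕜 ι h) := inferInstanceAs (Algebra 𝕜 (GrassmannAlgebra 𝕜 ι))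

/-- The identity map to the underlying Grassmann algebra (same ring, norm forgotten).
[cite: Dimock2002QED3TorusI, App. B (298) p.62 L1–8] -/
def toGrassmann (F : HGrassmann 𝕜 ι h) : GrassmannAlgebra 𝕜 ι := F

/-- … and back: an element of the Grassmann algebra regarded in `(𝒢, ‖·‖_h)`.
[cite: Dimock2002QED3TorusI, App. B (298) p.62 L1–8] -/
def ofGrassmann (F : GrassmannAlgebra 𝕜 ι) : HGrassmann 𝕜 ι h := F


/-! ## (299) is a norm: the missing elementary facts about `hNorm` -/

/-- `‖−F‖_h = ‖F‖_h`. [cite: Dimock2002QED3TorusI, App. B (299) p.62 L9–13 («a norm»)] -/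
theorem hNorm_neg (h : ℝ) (F : GrassmannAlgebra 𝕜 ι) : hNorm h (-F) = hNorm h F := by
  have e := hNorm_smul h (-1 : 𝕜) F
  rwa [neg_one_smul, norm_neg, norm_one, one_mul] at e

/-- `‖0‖_h = 0`. [cite: Dimock2002QED3TorusI, App. B (299) p.62 L9–13 («a norm»)] -/
theorem hNorm_zero (h : ℝ) : hNorm h (0 : GrassmannAlgebra 𝕜 ι) = 0 := by
  simp [hNorm, coeff]

/-- **definiteness** (`h > 0`): `‖F‖_h = 0 ⟹ F = 0` — every coefficient `c_S(F)` vanishes, and the monomials are a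
basis. [cite: Dimock2002QED3TorusI, App. B (298)–(299) p.62 L1–13 («any element can be uniquely written … a norm»)] -/
theorem eq_zero_of_hNorm_eq_zero {h : ℝ} (hh : 0 < h) {F : GrassmannAlgebra 𝕜 ι} (hF : hNorm h F = 0) :
    F = 0 := by
  have hterm : ∀ S ∈ (Finset.univ : Finset (Finset ι)), h ^ S.card * ‖coeff F S‖ = 0 :=
    (Finset.sum_eq_zero_iff_of_nonneg fun S _ => by positivity).mp hF
  apply (grassmannBasis 𝕜 ι).repr.injective
  ext S
  have hS := hterm S (Finset.mem_univ S)
  rw [mul_eq_zero] at hS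
  rcases hS with h1 | h1
  · exact absurd h1 (pow_ne_zero _ hh.ne')
  · simpa [coeff] using h1

/-! ## The instances: `(𝒢, ‖·‖_h)` is a complete normed algebra with `‖1‖ = 1` -/

variable [Fact (0 < h)]

/-- (299) as an `AddGroupNorm` on the synonym. [cite: Dimock2002QED3TorusI, App. B (299) p.62 L9–13] -/
def hAddGroupNorm : AddGroupNorm (HGrassmann 𝕜 ι h) where
  toFun F := hNorm h (toGrassmann F)
  map_zero' := hNorm_zero h
  add_le' F G := hNorm_add_le (Fact.out : 0 < h).le (toGrassmann F) (toGrassmann G)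
  neg' F := hNorm_neg h (toGrassmann F)
  eq_zero_of_map_eq_zero' _ hF := eq_zero_of_hNorm_eq_zero (Fact.out : 0 < h) hF

/-- `(𝒢, ‖·‖_h)` as a normed additive group. [cite: Dimock2002QED3TorusI, App. B (299) p.62 L9–13] -/
instance instNormedAddCommGroup : NormedAddCommGroup (HGrassmann 𝕜 ι h) :=
  (hAddGroupNorm (𝕜 := 𝕜) (ι := ι) (h := h)).toNormedAddCommGroup

/-- Unfolding: the norm of the synonym IS `‖·‖_h`. [cite: Dimock2002QED3TorusI, App. B (299) p.62 L9–13] -/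
theorem norm_def (F : HGrassmann 𝕜 ι h) : ‖F‖ = hNorm h (toGrassmann F) := rfl

/-- **LEMMA 19 packaged: `(𝒢, ‖·‖_h)` is a normed ring** (`‖FG‖ ≤ ‖F‖‖G‖` = the tree's `hNorm_mul_le`).
[cite: Dimock2002QED3TorusI, App. B Lemma 19 p.62 L14–24; Dimock2022UVStabilityQED3, App. B (529)–(531) p.73 L25 – p.74 L11] -/
instance instNormedRing : NormedRing (HGrassmann 𝕜 ι h) :=
  { instNormedAddCommGroup, (inferInstance : Ring (HGrassmann 𝕜 ι h)) with
    dist_eq := fun _ _ => rfl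
    norm_mul_le := fun F G => hNorm_mul_le (Fact.out : 0 < h).le (toGrassmann F) (toGrassmann G) }

/-- `‖1‖_h = 1`. [cite: Dimock2002QED3TorusI, App. B (299) p.62 L9–13] -/
instance instNormOneClass : NormOneClass (HGrassmann 𝕜 ι h) := ⟨hNorm_one h⟩

/-- `‖cF‖_h ≤ |c|‖F‖_h` (in fact `=`). [cite: Dimock2002QED3TorusI, App. B (299) p.62 L9–13] -/
instance instNormedSpace : NormedSpace 𝕜 (HGrassmann 𝕜 ι h) where
  norm_smul_le c F := (hNorm_smul h c (toGrassmann F)).le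

/-- `(𝒢, ‖·‖_h)` is a normed `𝕜`-algebra. [cite: Dimock2002QED3TorusI, App. B (299), Lemma 19 p.62 L9–24] -/
instance instNormedAlgebra : NormedAlgebra 𝕜 (HGrassmann 𝕜 ι h) where
  norm_smul_le c F := (hNorm_smul h c (toGrassmann F)).le

/-- finitely many generators ⟹ finite-dimensional (the monomial basis indexed by `Finset ι`).
[cite: Dimock2002QED3TorusI, App. B (298) p.62 L1–8] -/
instance instFiniteDimensional : FiniteDimensional 𝕜 (HGrassmann 𝕜 ι h) :=
  Module.Finite.of_basis (grassmannBasis 𝕜 ι)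

/-- … hence COMPLETE: `(𝒢, ‖·‖_h)` is a Banach algebra. [cite: Dimock2002QED3TorusI, App. B (299), Lemma 19 p.62 L9–24] -/
instance instCompleteSpace : CompleteSpace (HGrassmann 𝕜 ι h) := FiniteDimensional.complete 𝕜 (HGrassmann 𝕜 ι h)

/-- `‖1‖ = 1` as an equation. [cite: Dimock2002QED3TorusI, App. B (299) p.62 L9–13] -/
theorem norm_toGrassmann_one : ‖(1 : HGrassmann 𝕜 ι h)‖ = 1 := norm_one

/-- a generator has norm `h`: `‖Ψ(ξ)‖_h = h`. [cite: Dimock2002QED3TorusI, App. B (299) p.62 L9–13] -/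
theorem norm_gen (ξ : ι) : ‖(ofGrassmann (gen 𝕜 ξ) : HGrassmann 𝕜 ι h)‖ = h := hNorm_gen h ξ

/-- a monomial has norm `h^{#S}`: `‖Ψ(ξ₁)⋯Ψ(ξ_r)‖_h = h^r`. [cite: Dimock2002QED3TorusI, App. B (299) p.62 L9–13] -/
theorem norm_grassmannBasis (S : Finset ι) :
    ‖(ofGrassmann (grassmannBasis 𝕜 ι S) : HGrassmann 𝕜 ι h)‖ = h ^ S.card :=
  hNorm_grassmannBasis h S

/-- the same `ℚ`-algebra as the Grassmann algebra (so that the algebraic exponential `QuantumLattice.grassmannExp` and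
Mathlib's `NormedSpace.exp` live on one structure). [cite: Dimock2002QED3TorusI, App. B (298) p.62 L1–8] -/
instance instAlgebraRat : Algebra ℚ (HGrassmann 𝕜 ι h) := inferInstanceAs (Algebra ℚ (GrassmannAlgebra 𝕜 ι))

/-- **The Banach-algebra exponential IS the tree's algebraic Grassmann exponential on nilpotent elements**: if
`E^k = 0` then `e^E` (`NormedSpace.exp` in `(𝒢, ‖·‖_h)`, the object bounded in (511)–(514)) equals
`QuantumLattice.grassmannExp E = Σ_{i<k} Eⁱ∕i!` (the exponential of the tree's Grassmann–Gaussian calculus) — the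
exponential series terminates. [cite: Dimock2022UVStabilityQED3, §4.2.3 Lemma 26 proof (505)–(506), (511) p.69 L15–22, L112–137] -/
theorem exp_eq_grassmannExp {E : HGrassmann 𝕜 ι h} {k : ℕ} (hk : E ^ k = 0) :
    toGrassmann (NormedSpace.exp E) = grassmannExp (toGrassmann E) := by
  have h1 : NormedSpace.exp E = IsNilpotent.exp E := by
    rw [IsNilpotent.exp_eq_sum hk, congrFun NormedSpace.exp_eq_tsum_rat E]
    refine tsum_eq_sum fun n hn => ?_
    rw [Finset.mem_range, not_lt] at hn
    rw [pow_eq_zero_of_le hn hk, smul_zero]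
  rw [h1]
  rfl

/-! ## Real scalars (reducible `def`s, not instances) -/

/-- Real scalars acting through `ℝ → 𝕜` (a reducible `def`, NOT an instance: no instance diamond is created on the
synonym — for `𝕜 = ℂ` Mathlib's `NormedAlgebra.complexToReal` is available; use `letI := normedAlgebraReal` locally).
[cite: Dimock2002QED3TorusI, App. B (299) p.62 L9–13] -/
@[reducible] def algebraReal : Algebra ℝ (HGrassmann 𝕜 ι h) :=
  ((algebraMap 𝕜 (HGrassmann 𝕜 ι h)).comp (algebraMap ℝ 𝕜)).toAlgebra' fun c x =>
    Algebra.commutes (algebraMap ℝ 𝕜 c) x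

/-- The real normed-algebra structure `‖r • F‖_h ≤ |r|‖F‖_h` (reducible `def`, see `algebraReal`).
[cite: Dimock2002QED3TorusI, App. B (299) p.62 L9–13] -/
@[reducible] def normedAlgebraReal : NormedAlgebra ℝ (HGrassmann 𝕜 ι h) :=
  letI : Algebra ℝ (HGrassmann 𝕜 ι h) := algebraReal
  { (algebraReal : Algebra ℝ (HGrassmann 𝕜 ι h)) with
    norm_smul_le := fun r F => by
      change ‖algebraMap 𝕜 (HGrassmann 𝕜 ι h) (algebraMap ℝ 𝕜 r) * F‖ ≤ ‖r‖ * ‖F‖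
      rw [← Algebra.smul_def, norm_def, norm_def]
      change hNorm h ((algebraMap ℝ 𝕜 r) • toGrassmann F) ≤ ‖r‖ * hNorm h (toGrassmann F)
      rw [hNorm_smul]
      simp }

/-! ## D8 LEMMA 26's closing step (511)–(514) ON the Grassmann algebra -/

/-- **(511)–(514) on `(𝒢, ‖·‖_h)`** — «`|∫f dμ_I| ≤ ‖f‖₁` … This implies `|Ξ_K(A)∕Z_f(N,0) − 1|` is bounded by
`‖E**‖₁e^{‖E**‖₁}`»: for any additive functional `μ` on the Grassmann algebra with `|μ F| ≤ ‖F‖_h` and `μ 1 = 1`,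
`|μ(e^E) − 1| ≤ ‖E‖_h e^{‖E‖_h}` (`e^E` = `NormedSpace.exp` in the Banach algebra `HGrassmann`; the abstract theorem
is `QED3SmallFieldFermion.norm_functional_exp_sub_one_le`).
[cite: Dimock2022UVStabilityQED3, §4.2.3 Lemma 26 proof (511)–(514) p.69 L112 – p.70 L33; p.61 L57] -/
theorem norm_functional_exp_sub_one_le_grassmann (μ : HGrassmann 𝕜 ι h →+ 𝕜)
    (hμ : ∀ F, ‖μ F‖ ≤ ‖F‖) (hμ1 : μ 1 = 1) (E : HGrassmann 𝕜 ι h) :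
    ‖μ (NormedSpace.exp E) - 1‖ ≤ ‖E‖ * Real.exp ‖E‖ := by
  letI : NormedAlgebra ℝ (HGrassmann 𝕜 ι h) := normedAlgebraReal
  exact QED3SmallFieldFermion.norm_functional_exp_sub_one_le μ hμ hμ1 E

/-- **LEMMA 26 (503) on `(𝒢, ‖·‖₁)`-type norms** — with (513) `‖E‖_h ≤ c·e_K^{1∕4−7ε}·T`, `c·e_K^{1∕4−7ε}·T ≤ 1` and
`e·c·T·e_K^{ε} ≤ 1`: `|μ(e^E) − 1| ≤ e_K^{1∕4−8ε}` (the abstract `QED3SmallFieldFermion.lemma26_closing`).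
[cite: Dimock2022UVStabilityQED3, §4.2.3 Lemma 26 (503) p.69 L1–3; proof (511)–(514) p.69 L112 – p.70 L33] -/
theorem lemma26_closing_grassmann (μ : HGrassmann 𝕜 ι h →+ 𝕜) (hμ : ∀ F, ‖μ F‖ ≤ ‖F‖) (hμ1 : μ 1 = 1)
    {E : HGrassmann 𝕜 ι h} {c T eK ε : ℝ} (heK : 0 < eK) (hc : 0 ≤ c) (hT : 0 ≤ T)
    (h513 : ‖E‖ ≤ c * eK ^ (1 / 4 - 7 * ε) * T) (hprod : c * eK ^ (1 / 4 - 7 * ε) * T ≤ 1)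
    (hlog : Real.exp 1 * c * T * eK ^ ε ≤ 1) :
    ‖μ (NormedSpace.exp E) - 1‖ ≤ eK ^ (1 / 4 - 8 * ε) := by
  letI : NormedAlgebra ℝ (HGrassmann 𝕜 ι h) := normedAlgebraReal
  exact QED3SmallFieldFermion.lemma26_closing μ hμ hμ1 heK hc hT h513 hprod hlog

/-- **(511)–(514) for the Gaussian Grassmann integral itself** (D12 App. B LEMMA 21 «`|∫F dμ_Γ| ≤ ‖F‖_h` whenever
`√‖Γ‖₍₂₎ ≤ h`», in the tree as `QED3TorusI.norm_gaussExpect_le_hNorm`, supplies the contracting functional; `∫1 dμ_Γ = 1`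
is the tree's `gaussExpect_one`): `|∫e^{E}dμ_Γ − 1| ≤ ‖E‖_h e^{‖E‖_h}`.  For `Γ` = the identity pairing and `h = 1` this
is literally the printed «`|Ξ_K(A)∕Z_f(N,0) − 1| ≤ ‖E**‖₁e^{‖E**‖₁}`» step.
[cite: Dimock2022UVStabilityQED3, §4.2.3 Lemma 26 proof (511)–(514) p.69 L112 – p.70 L33; Dimock2002QED3TorusI, App. B Lemma 21 (311) p.64 L1–12] -/
theorem norm_gaussExpect_exp_sub_one_le (q : ι → Bool) (C : Matrix ι ι 𝕜) (hC : ∀ X Y, q X = q Y → C X Y = 0)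
    (hΓ : Real.sqrt (twoNorm q (contr 𝕜 C)) ≤ h) (E : HGrassmann 𝕜 ι h) :
    ‖gaussExpect 𝕜 C (toGrassmann (NormedSpace.exp E)) - 1‖ ≤ ‖E‖ * Real.exp ‖E‖ :=
  norm_functional_exp_sub_one_le_grassmann
    ((gaussExpect 𝕜 C).toAddMonoidHom : HGrassmann 𝕜 ι h →+ 𝕜)
    (fun F => norm_gaussExpect_le_hNorm q C hC hΓ (toGrassmann F)) (gaussExpect_one 𝕜 C) E

end HGrassmann

end Literature.MathematicalPhysics.QuantumFieldTheory.Dimock2011to13
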